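import Literature.AlgebraicGeometry.HodgeTheory.MiddleDimensionReductionDischarge
import Literature.NumberTheory.Transcendental.DeRhamTheoremProofs
import HarnessLib

/-!
# BFNP Lemma 48 (`middleDimensionReduction`) from the Hodge decomposition and rigidity alone

With de Rham's theorem now proved in the tree (`exists_isNatural_deRhamIsoFamily`,
`exists_complexDeRhamIsoFamily_holds` of `…Transcendental.DeRhamTheoremProofs`: the natural real
and complex de Rham isomorphism families, by integration over smooth simplices and Bredon's
bootstrap), the first of the three roots of the reduction
`middleDimensionReduction_of_deRham_of_hodgeDecomposition_of_rigidity`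
(`MiddleDimensionReductionDischarge`) is discharged: Brosnan–Fang–Nie–Pearlstein (2009), §6,
Lemma 48 (`middleDimensionReduction`) follows from (2) the Hodge decomposition of compact Kähler
manifolds (`Motives.isInternal_hodgePQ`; Voisin I, Prop. 6.11), (3) the rigidity of natural de
Rham comparisons (`NaturalDeRhamComparisonRigidity`) and the Hodge bidegree of cup products
(`CupPreservesHodgeType`, the only place where the multiplicativity clause of the real de Rham
fact is still used); and Hodge models exist from (2) alone (`nonempty_hodgeModel_of_hodgeDecomposition`). The Hodge models come from
`nonempty_hodgeModel_of_isNatural_of_hodgeDecomposition` (which needs only a NATURAL real family,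
Warner 5.36/5.38), fed with the integration family.

## References

* P. Brosnan, H. Fang, Z. Nie, G. Pearlstein, *Singularities of admissible normal functions*,
  Invent. Math. 177 (2009), §6, Lemma 48.
* C. Voisin, *Hodge Theory and Complex Algebraic Geometry I* (2002), Prop. 6.11, §7.3.2.
* G. E. Bredon, *Topology and Geometry* (1993), Thm. V.9.5 (de Rham's theorem).
-/

open scoped Manifold ContDiff

namespace Literature.AlgebraicGeometry.HodgeTheory

/-- **BFNP Lemma 48 from the Hodge decomposition, rigidity and the Hodge bidegree of cup
products** (root (1), de Rham's theorem as a NATURAL family, is now the theorem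
`exists_isNatural_deRhamIsoFamily`; what remains of it is only its multiplicativity clause,
entering through `CupPreservesHodgeType`): if (2) compact Kähler manifolds have the Hodge
decomposition (`Motives.isInternal_hodgePQ`), (3) natural de Rham comparisons are rigid across
diffeomorphisms (`NaturalDeRhamComparisonRigidity`) and (1ₘ) cup products of rational classes of
Hodge type `(p, p)` and `(q, q)` have Hodge type `(p + q, p + q)` on smooth projective varieties
(`CupPreservesHodgeType`, which the tree derives from the MULTIPLICATIVE real de Rham theorem,
`cupPreservesHodgeType_of_nonempty_hodgeModel`), then `middleDimensionReduction` holds — if every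
rational middle-degree Hodge class on every even-dimensional smooth projective complex variety is
algebraic, then so is every rational `(p, p)`-class on every smooth projective complex variety.
Assembly as in `middleDimensionReduction_of_deRham_of_hodgeDecomposition_of_rigidity`, with the
Hodge models supplied by `nonempty_hodgeModel_of_isNatural_of_hodgeDecomposition` and the
integration de Rham family. [cite: BrosnanFangNiePearlstein2009, §6 Lemma 48]
[cite: VoisinHodgeI2002, §6.1.3 Prop. 6.11 and §7.3.2] -/
theorem middleDimensionReduction_of_hodgeDecomposition_of_rigidity_of_cup
    (hHD : ∀ (E : Type) [NormedAddCommGroup E] [NormedSpace ℂ E] [FiniteDimensional ℂ E]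
      (M : Type) [TopologicalSpace M] [ChartedSpace E M] [IsManifold 𝓘(ℝ, E) ∞ M],
      Motives.isInternal_hodgePQ (E := E) (M := M))
    (hR : NaturalDeRhamComparisonRigidity)
    (hcup : ∀ ⦃n : ℕ⦄ ⦃X : Motives.SchemeOver ℂ⦄, Motives.IsSmoothProjective n X → CupPreservesHodgeType n X) :
    middleDimensionReduction :=
  have h3 : ∀ (E : Type) [NormedAddCommGroup E] [NormedSpace ℂ E] [FiniteDimensional ℂ E],
      ∃ e : Literature.NumberTheory.Transcendental.DeRhamIsoFamily 𝓘(ℝ, E), e.IsNatural :=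
    fun E _ _ _ ↦
      let ⟨e, he, _⟩ := Literature.NumberTheory.Transcendental.exists_isNatural_deRhamIsoFamily E
      ⟨e, he⟩
  have hA : ∀ ⦃n : ℕ⦄ ⦃X : Motives.SchemeOver ℂ⦄, nonempty_hodgeModel n X :=
    fun n X ↦ nonempty_hodgeModel_of_isNatural_of_hodgeDecomposition h3 hHD n X
  have hI : hodgePQ_independent_of_hodgeModel :=
    hodgePQ_independent_of_hodgeModel_of_naturalDeRhamComparisonRigidity hR
  middleDimensionReduction_of_nonempty_hodgeModel hA hI hcup

/-- **Hodge models of all smooth projective complex varieties from the Hodge decomposition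
alone** (root (1) discharged by the integration de Rham family): if compact Kähler manifolds have
the Hodge decomposition then every smooth projective `X/ℂ` of dimension `n` has a Hodge model
(`nonempty_hodgeModel_of_isNatural_of_hodgeDecomposition` with `exists_isNatural_deRhamIsoFamily`).
[cite: VoisinHodgeI2002, §6.1.3 Prop. 6.11] -/
theorem nonempty_hodgeModel_of_hodgeDecomposition
    (hHD : ∀ (E : Type) [NormedAddCommGroup E] [NormedSpace ℂ E] [FiniteDimensional ℂ E]
      (M : Type) [TopologicalSpace M] [ChartedSpace E M] [IsManifold 𝓘(ℝ, E) ∞ M],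
      Motives.isInternal_hodgePQ (E := E) (M := M)) (n : ℕ) (X : Motives.SchemeOver ℂ) :
    nonempty_hodgeModel n X :=
  nonempty_hodgeModel_of_isNatural_of_hodgeDecomposition
    (fun E _ _ _ ↦
      let ⟨e, he, _⟩ := Literature.NumberTheory.Transcendental.exists_isNatural_deRhamIsoFamily E
      ⟨e, he⟩) hHD n X

end Literature.AlgebraicGeometry.HodgeTheory
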